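import Summits.Schanuel.Schanuel.Theorems.RootDecomp1KCollarCell05

/-!
# RootDecomp1KCollarCell — lens 1, generation 48, node 7 «THE COLLAR CELL: skeleton-RESONANT dyadic approximants are never level points (2-adic interlacing, all P, m-free), with a certified member of EXACT Skel-order m» (CLAIM L2417, EX-ANTE PRICE + CHECKLIST K-g48 L2418, NODE L2431 / REQUEST L2432; critic VERDICT L2435: CLEARED AS PRICED — ONE CELL ×1 «DYADIC COLLAR», RULE K-R37, PORT GO) — continuation (RootDecomp1KCollarCell06): §5 the exhibited tuple z♮₂ = (ℓ₂, ρ♮₂) and the item-31077 instance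

(lens-1 g48 HOME kernel K = HOME/decomp-schanuel-lens-1/g48/CollarCell.lean f82e9183…, 1281 l, imports …RootDecomp1KDegreeLadder05 + …RootDecomp1KDarkLogSq04 BY NAME; P CollarCellProbe.lean 50792f78… rc 0 / C CollarCellCtrl.lean 9aabc182… rc 1 = 14 planted; memo NODE-g48.md; NODE L2431 / REQUEST L2432. Port by census-1 gen 21 as `RootDecomp1KCollarCell01–06` along K's §1–§5 with §3 cut in two by the 400-line file cap: 01 = §1 (T1) the 2-adic interlacing lemma `twoAdic_bev_ne_zero` with `maxval₂`, `weights_injective`; 02 = §2 the class `DyadicCollarLiouville` («[class] definition» tag) and its engine `bev_ne_zero_of_collar` (T2), `algebraicIndependent_ell2_of_collar` (T3), `statement_b_on_collar_ge_one`, `not_dyadicCollarLiouville_uStar`, `sb_collarPair` / `coordLiouvilleSchanuel_collarPair` (T4, item 31077's binders verbatim at n = 2, whole class, hyp-free); 03 = §3a the run pattern `Nn`/`fN`/`gN`, increments `aN`, `rhoNat`, tails `tailN`; 04 = §3b numerators `MN`, truncations `tN`, overshoots `uN`/`UN`, `iota_two_pow_fN`, `rhoNat_ne_tN`; 05 = §4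 certificates M1 `dyadicCollarLiouville_rhoNat`, M2 `skelLiouvilleFix_rhoNat`, cover `rhoNat_cover`, M3 `not_skelLiouvilleFix_succ_rhoNat` / `not_skelLiouville_rhoNat`, M4 `not_factorialGapLiouville_rhoNat`, M5 `not_logLogLiouville_rhoNat` + `not_logSqLiouville_rhoNat` / `not_logHyperLiouville_rhoNat` / `not_hyperLiouville_rhoNat` / `not_liouvilleOrder_rhoNat`, `liouville_rhoNat`, `dyadicCollarLiouville_not_subset`; 06 = §5 the exhibited tuple `zN2 = (ℓ₂, ρ♮₂)`: `linearIndependent_zN2`, `coordLiouvilleSpan_zN2`, `zN2_in_scope_31077`, `sb_zN2`, `coordLiouvilleSchanuel_at_zN2`, `item31077_at_zN2`, `rhoNat_two_profile` — ALL HYP-FREE. PORT EDITS (census convention, as sanctioned for every K-line port): `set_option linter.dupNamespace false` dropped; «[class] definition (membership predicate with parameters, NOT a fact; census convention)» wording on `DyadicCollarLiouville`; 35 one-line helper docstrings added; K's `liouvilleNumber_two_lt` (§2) DELETED in favour of the byte-identical tree decl `RootDecomp1KRelLiouvilleCell.liouvilleNumber_two_lt` (RelLiouvilleCell03, already in the import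 cone; dedup bounce p838600) — referenced via the §2 `open … (… liouvilleNumber_two_lt)` list; two generic §1 one-liners privatised; per-part private helper copies if any; statements and proofs otherwise verbatim (no renames). `--supports stmt-Schanuel-31077`; no census credit carried; rung 0 — nothing here proves Schanuel; no ∀-item moves; 31077 and 33364 stay OPEN.)
-/

noncomputable section

open Polynomial LiouvilleNumber
open scoped Nat

namespace Summit.Schanuel.Schanuel.Theorems.RootDecomp1KCollarCell

open Summit.Schanuel.Schanuel.Theorems.RootDecomp1KDegreeLadder
  (bev bev_eq_double_sum xdeg natDegree_coeff_le_xdeg specX aeval_specX natDegree_specX_le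
   abs_aeval_ge_of_ne_zero lipschitz_x lipschitz_y algebraicIndependent_of_no_relation)
open Summit.Schanuel.Schanuel.Theorems.RootDecomp1KSkelCell
  (iota iota_spec iota_le_of_le pow_lt_of_lt_iota lt_iota_of_pow_lt iota_mono one_le_iota
   SkelLiouville SkelLiouvilleFix skelLiouville_iff_fix SkelLiouvilleFix.mono logLogLiouville_skelLiouville)
open Summit.Schanuel.Schanuel.Theorems.RootDecomp1KLogLogCell
  (LogLogLiouville logLogLiouville_of_logSqLiouville logLogLiouville_of_logHyperLiouville
   logLogLiouville_of_hyperLiouville)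
open Summit.Schanuel.Schanuel.Theorems.RootDecomp1KGeneric (LogSqLiouville LiouvilleOrder)
open Summit.Schanuel.Schanuel.Theorems.RootDecomp1KRelLiouvilleCell (LogHyperLiouville)
open Summit.Schanuel.Schanuel.Theorems.RootDecomp1KDarkLogSq (logHyperLiouville_of_liouvilleOrder)
open Summit.Schanuel.Schanuel.Theorems.RootDecomp1KTwoBaseCell
  (psNumer partialSum_eq_psNumer_div coprime_psNumer sb_of_range_eq')
open Summit.Schanuel.Schanuel.Theorems.RootDecomp1KGapCell (FactorialGapLiouville)
open Summit.Schanuel.Schanuel.Theorems.RootDecomp1KHyper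
open Summit.Schanuel.Schanuel.Theorems.RootDecomp1KHyper.HyperCell

/-! ## §5  THE EXHIBITED MEMBER `z♮₂ := (ℓ₂, ρ♮₂)` AND THE ITEM INSTANCE OF `CoordLiouvilleSchanuel` (31077) -/
section Item

/-- `z♮₂ := (ℓ₂, ρ♮₂)`. -/
def zN2 : Fin 2 → ℂ := ![((liouvilleNumber 2 : ℝ) : ℂ), (rhoNat 2 : ℂ)]

/-- Read-back: `z♮₂ = (ℓ₂, ρ♮₂)` as a `Fin 2`-tuple of complex numbers. -/
theorem zN2_eq : zN2 = ![((liouvilleNumber 2 : ℝ) : ℂ), ((rhoNat 2 : ℝ) : ℂ)] := rfl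

/-- exact order at `m = 2`: `ρ♮₂ ∈ Skel_2 \ Skel_3`, in the collar class, outside the gap class. -/
theorem rhoNat_two_profile :
    DyadicCollarLiouville (rhoNat 2) ∧ SkelLiouvilleFix 2 (rhoNat 2) ∧ ¬ SkelLiouvilleFix 3 (rhoNat 2) ∧
      ¬ FactorialGapLiouville (rhoNat 2) ∧ ¬ LogLogLiouville (rhoNat 2) :=
  ⟨dyadicCollarLiouville_rhoNat (by norm_num), skelLiouvilleFix_rhoNat (by norm_num),
    not_skelLiouvilleFix_succ_rhoNat (by norm_num), not_factorialGapLiouville_rhoNat (by norm_num),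
    not_logLogLiouville_rhoNat (by norm_num)⟩

/-- `z♮₂ = (ℓ₂, ρ♮₂)` is algebraically independent over `ℚ` (hypothesis-free). -/
theorem algebraicIndependent_zN2 : AlgebraicIndependent ℚ zN2 :=
  algebraicIndependent_ell2_of_collar (dyadicCollarLiouville_rhoNat (by norm_num))

/-- binder 1 of the item, hyp-free: `z♮₂` is ℚ-linearly independent. -/
theorem linearIndependent_zN2 : LinearIndependent ℚ zN2 := algebraicIndependent_zN2.linearIndependent

/-- binder 2 of the item, hyp-free: a Liouville coordinate in the ℚ-span (`ℓ₂` itself, Mathlib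
`liouville_liouvilleNumber`). -/
theorem coordLiouvilleSpan_zN2 : ∃ w ∈ Submodule.span ℚ (Set.range zN2), Liouville w.re ∨ Liouville w.im :=
  ⟨zN2 0, Submodule.subset_span ⟨0, rfl⟩, Or.inl (by simpa [zN2] using liouville_liouvilleNumber (le_refl 2))⟩

/-- `z♮₂` is in the scope of item 31077 (both binders discharged). -/
theorem zN2_in_scope_31077 :
    LinearIndependent ℚ zN2 ∧ ∃ w ∈ Submodule.span ℚ (Set.range zN2), Liouville w.re ∨ Liouville w.im :=
  ⟨linearIndependent_zN2, coordLiouvilleSpan_zN2⟩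

/-- Schanuel's bound at `z♮₂`, hypothesis-free. -/
theorem sb_zN2 : SB 2 zN2 := sb_collarPair (dyadicCollarLiouville_rhoNat (by norm_num))

/-- the item's conclusion at `z♮₂`, hypothesis-free and spelled out. -/
theorem coordLiouvilleSchanuel_at_zN2 :
    ((2 : ℕ) : Cardinal) ≤ Algebra.trdeg ℚ
      ↥(IntermediateField.adjoin ℚ (Set.range zN2 ∪ Set.range (Complex.exp ∘ zN2))) := sb_zN2

/-- READ-BACK: the live item `CoordLiouvilleSchanuel` (31077), applied at `z♮₂`, yields exactly `sb_zN2`'s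
statement — i.e. `z♮₂` is an instance the item quantifies over, now decided without the item. -/
theorem item31077_at_zN2
    (h31077 : ∀ (n : ℕ) (z : Fin n → ℂ), LinearIndependent ℚ z →
      (∃ w ∈ Submodule.span ℚ (Set.range z), Liouville w.re ∨ Liouville w.im) →
      (n : Cardinal) ≤ Algebra.trdeg ℚ ↥(IntermediateField.adjoin ℚ (Set.range z ∪ Set.range (Complex.exp ∘ z)))) :
    SB 2 zN2 :=
  h31077 2 zN2 linearIndependent_zN2 coordLiouvilleSpan_zN2

end Item

end Summit.Schanuel.Schanuel.Theorems.RootDecomp1KCollarCell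

end
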